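/-
Copyright (c) 2026. Released under Apache 2.0 license.
-/
import Literature.NumberTheory.Automorphic.UnboundedDenominatorsInvariantHom
import Mathlib.GroupTheory.PGroup
import Mathlib.GroupTheory.GroupAction.ConjAct
import HarnessLib

/-!
# The invariant form of CDT Cor. 4.5.3: the transfer step at a prime already dividing the level

For `p ∣ M` the quotient `Γ(M)/Γ(Mp)` is a `p`-group (`(1 + M A)^p ≡ 1 (mod Mp)`).  Transferring an
`SL₂(ℤ)`-invariant homomorphism `θ : Γ(Mp) → Q` of exponent `e` prime to `p` up to `Γ(M)` gives an invariant
homomorphism `ψ : Γ(M) → Q` with `ψ = θ^{[Γ(M):Γ(Mp)]}` on `Γ(Mp)`; hence **whatever principal congruence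
subgroup the invariant homomorphisms `Γ(M) → Q` kill, `θ` kills too** (`map_eq_one_of_transfer_step`).  This
removes from the level every prime power `p^k` with `p ∤ e`: the invariant form of Cor. 4.5.3 for a target of
`ℓ`-power exponent reduces to levels `N` with `ℓ² ∣ N` or `N` squarefree-at-every-`p ≠ ℓ`.

* `pow_mem_Gamma_mul_of_dvd` — `p ∣ M`, `x ∈ Γ(M)` ⟹ `x^p ∈ Γ(Mp)`;
* `exists_index_subgroupOf_Gamma_mul_eq_pow` — `[Γ(M) : Γ(Mp)]` is a power of `p`;
* `map_eq_one_of_transfer_step` — the transfer step.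

[cite: CalegariDimitrovTang2025, Corollary 4.5.3]
-/

open scoped MatrixGroups

namespace Literature.NumberTheory.Automorphic

namespace UnboundedDenominators

open CongruenceSubgroup Matrix.SpecialLinearGroup ModularGroup

variable {Q : Type*} [CommGroup Q]

/-- `Γ(L) ≤ Γ(M)` for `M ∣ L`. [folklore] -/
private theorem Gamma_le_Gamma_of_dvd₅ {M L : ℕ} (h : M ∣ L) : Gamma L ≤ Gamma M := by
  intro γ hγ
  obtain ⟨h00, h01, h10, h11⟩ := Gamma_mem.mp hγ
  have cast_eq : ∀ a : ℤ, ((a : ZMod L).cast : ZMod M) = (a : ZMod M) := fun a ↦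
    ZMod.cast_intCast h a
  rw [Gamma_mem]
  refine ⟨?_, ?_, ?_, ?_⟩
  · rw [← cast_eq, h00, ZMod.cast_one h]
  · rw [← cast_eq, h01, ZMod.cast_zero]
  · rw [← cast_eq, h10, ZMod.cast_zero]
  · rw [← cast_eq, h11, ZMod.cast_one h]

/-- In a ring, `C² = 0` implies `(1 + C)^n = 1 + n • C`. [folklore] -/
private theorem one_add_pow_of_mul_self_eq_zero {R : Type*} [Ring R] {C : R} (hC : C * C = 0) (n : ℕ) :
    (1 + C) ^ n = 1 + n • C := by
  induction n with
  | zero => simp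
  | succ n ih =>
    rw [pow_succ, ih, succ_nsmul, add_mul, one_mul, mul_add, mul_one, smul_mul_assoc, hC, smul_zero,
      add_zero, add_assoc, add_comm C]

/-- An element of `Γ(M)` is `1 + M·B` for an integral matrix `B`. [folklore]
[cite: CalegariDimitrovTang2025, §4.5] -/
theorem exists_eq_one_add_smul_of_mem_Gamma {M : ℕ} {x : SL(2, ℤ)} (hx : x ∈ Gamma M) :
    ∃ B : Matrix (Fin 2) (Fin 2) ℤ, (x : Matrix (Fin 2) (Fin 2) ℤ) = 1 + (M : ℤ) • B := by
  obtain ⟨h00, h01, h10, h11⟩ := Gamma_mem.mp hx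
  have d00 : (M : ℤ) ∣ x 0 0 - 1 := by
    rw [← ZMod.intCast_zmod_eq_zero_iff_dvd]; push_cast; rw [h00, sub_self]
  have d01 : (M : ℤ) ∣ x 0 1 := by rw [← ZMod.intCast_zmod_eq_zero_iff_dvd]; exact h01
  have d10 : (M : ℤ) ∣ x 1 0 := by rw [← ZMod.intCast_zmod_eq_zero_iff_dvd]; exact h10
  have d11 : (M : ℤ) ∣ x 1 1 - 1 := by
    rw [← ZMod.intCast_zmod_eq_zero_iff_dvd]; push_cast; rw [h11, sub_self]
  obtain ⟨b00, hb00⟩ := d00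
  obtain ⟨b01, hb01⟩ := d01
  obtain ⟨b10, hb10⟩ := d10
  obtain ⟨b11, hb11⟩ := d11
  refine ⟨!![b00, b01; b10, b11], ?_⟩
  ext i j
  fin_cases i <;> fin_cases j
  · simp only [Fin.zero_eta, Fin.isValue, Matrix.add_apply, Matrix.one_apply_eq, Matrix.smul_apply,
      Matrix.of_apply, Matrix.cons_val', Matrix.cons_val_zero, Matrix.cons_val_fin_one, smul_eq_mul]
    linear_combination hb00
  · simp only [Fin.zero_eta, Fin.isValue, Fin.mk_one, Matrix.add_apply, ne_eq, zero_ne_one,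
      not_false_eq_true, Matrix.one_apply_ne, Matrix.smul_apply, Matrix.of_apply, Matrix.cons_val',
      Matrix.cons_val_one, Matrix.cons_val_fin_one, Matrix.cons_val_zero, smul_eq_mul, zero_add]
    linear_combination hb01
  · simp only [Fin.mk_one, Fin.isValue, Fin.zero_eta, Matrix.add_apply, ne_eq, one_ne_zero,
      not_false_eq_true, Matrix.one_apply_ne, Matrix.smul_apply, Matrix.of_apply, Matrix.cons_val',
      Matrix.cons_val_zero, Matrix.cons_val_fin_one, Matrix.cons_val_one, smul_eq_mul, zero_add]
    linear_combination hb10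
  · simp only [Fin.mk_one, Fin.isValue, Matrix.add_apply, Matrix.one_apply_eq, Matrix.smul_apply,
      Matrix.of_apply, Matrix.cons_val', Matrix.cons_val_one, Matrix.cons_val_fin_one, smul_eq_mul]
    linear_combination hb11

/-- **`p ∣ M` and `x ∈ Γ(M)` imply `x^p ∈ Γ(Mp)`**: `(1 + MB)^p = 1 + pMB + M²(…) ≡ 1 (mod Mp)`.
[folklore] [cite: CalegariDimitrovTang2025, §4.5] -/
theorem pow_mem_Gamma_mul_of_dvd {M p : ℕ} (hpM : p ∣ M) {x : SL(2, ℤ)} (hx : x ∈ Gamma M) :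
    x ^ p ∈ Gamma (M * p) := by
  obtain ⟨B, hB⟩ := exists_eq_one_add_smul_of_mem_Gamma hx
  rw [Gamma_mem']
  -- pass to matrices over `ZMod (M p)`
  apply Subtype.ext
  set f := Int.castRingHom (ZMod (M * p)) with hf
  have hmat : ((Matrix.SpecialLinearGroup.map f (x ^ p) : SL(2, ZMod (M * p))) :
      Matrix (Fin 2) (Fin 2) (ZMod (M * p))) = (f.mapMatrix (x : Matrix (Fin 2) (Fin 2) ℤ)) ^ p := by
    rw [map_pow]
    rfl
  rw [hmat, hB, map_add, map_one, Matrix.SpecialLinearGroup.coe_one]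
  set C : Matrix (Fin 2) (Fin 2) (ZMod (M * p)) := f.mapMatrix ((M : ℤ) • B) with hCdef
  obtain ⟨c, hc⟩ := hpM
  have hvan : ∀ y : ℤ, f ((M : ℤ) * M * y) = 0 ∧ f ((p : ℤ) * M * y) = 0 := by
    intro y
    refine ⟨(ZMod.intCast_zmod_eq_zero_iff_dvd _ _).mpr ⟨(c : ℤ) * y, ?_⟩,
      (ZMod.intCast_zmod_eq_zero_iff_dvd _ _).mpr ⟨y, ?_⟩⟩
    · rw [hc]; push_cast; ring
    · push_cast; ring
  have hCC : C * C = 0 := by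
    rw [hCdef, ← map_mul, Matrix.smul_mul, Matrix.mul_smul, smul_smul]
    ext i j
    simp only [RingHom.mapMatrix_apply, Matrix.map_apply, Matrix.smul_apply, smul_eq_mul,
      Matrix.zero_apply]
    exact (hvan _).1
  have hpC : p • C = 0 := by
    rw [hCdef, ← map_nsmul, ← natCast_zsmul, smul_smul]
    ext i j
    simp only [RingHom.mapMatrix_apply, Matrix.map_apply, Matrix.smul_apply, smul_eq_mul,
      Matrix.zero_apply]
    exact (hvan _).2
  rw [one_add_pow_of_mul_self_eq_zero hCC, hpC, add_zero]

/-- **`[Γ(M) : Γ(Mp)]` is a power of `p`** when `p ∣ M` (the quotient has exponent `p`).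
[folklore] [cite: CalegariDimitrovTang2025, §4.5] -/
theorem exists_index_subgroupOf_Gamma_mul_eq_pow {M p : ℕ} [NeZero M] (hp : p.Prime) (hpM : p ∣ M) :
    ∃ n : ℕ, ((Gamma (M * p)).subgroupOf (Gamma M)).index = p ^ n := by
  haveI : Fact p.Prime := ⟨hp⟩
  haveI : NeZero (M * p) := ⟨Nat.mul_ne_zero (NeZero.ne M) hp.ne_zero⟩
  haveI := Gamma_normal (M * p)
  set H : Subgroup (Gamma M) := (Gamma (M * p)).subgroupOf (Gamma M) with hH
  haveI : H.Normal := by rw [hH]; infer_instance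
  haveI : H.FiniteIndex := by rw [hH]; infer_instance
  have hP : IsPGroup p (Gamma M ⧸ H) := by
    intro g
    induction g using QuotientGroup.induction_on with
    | H x =>
      refine ⟨1, ?_⟩
      rw [pow_one, ← QuotientGroup.mk_pow, QuotientGroup.eq_one_iff, hH, Subgroup.mem_subgroupOf,
        Subgroup.coe_pow]
      exact pow_mem_Gamma_mul_of_dvd hpM x.2
  obtain ⟨n, hn⟩ := IsPGroup.iff_card.mp hP
  exact ⟨n, by rw [Subgroup.index_eq_card, hn]⟩

/-- Two coprime exponents kill an element. [folklore] -/
private theorem eq_one_of_pow_eq_one_of_coprime {G : Type*} [Monoid G] {q : G} {a b : ℕ}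
    (hab : a.Coprime b) (ha : q ^ a = 1) (hb : q ^ b = 1) : q = 1 := by
  have h := pow_gcd_eq_one.mpr ⟨ha, hb⟩
  rwa [Nat.Coprime.gcd_eq_one hab, pow_one] at h

/-- **The transfer step.**  Let `p ∣ M`, let `Q` be commutative of exponent `e` prime to `p`, and suppose every
`SL₂(ℤ)`-conjugation-invariant homomorphism `Γ(M) → Q` is trivial on `Γ(M) ∩ Γ(M₀)`.  Then every invariant
homomorphism `θ : Γ(Mp) → Q` is trivial on `Γ(Mp) ∩ Γ(M₀)`.  (Transfer `θ` from `Γ(Mp)` up to `Γ(M)`: the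
transfer `ψ` equals `θ^{[Γ(M):Γ(Mp)]}` on `Γ(Mp)`, the index is a power of `p`, and `ψ` is again invariant
because `ψ(g·g⁻¹)/ψ` factors through the `p`-group `Γ(M)/Γ(Mp)` into a group of exponent `e`.)
[cite: CalegariDimitrovTang2025, Corollary 4.5.3] -/
theorem map_eq_one_of_transfer_step {M p e M₀ : ℕ} [NeZero M] (hp : p.Prime) (hpM : p ∣ M)
    (hcop : e.Coprime p) (hQ : ∀ q : Q, q ^ e = 1)
    (hM : ∀ ψ : Gamma M →* Q,
      (∀ (g x : SL(2, ℤ)) (hx : x ∈ Gamma M) (hgx : g * x * g⁻¹ ∈ Gamma M),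
        ψ ⟨g * x * g⁻¹, hgx⟩ = ψ ⟨x, hx⟩) →
      ∀ (x : SL(2, ℤ)) (hx : x ∈ Gamma M), x ∈ Gamma M₀ → ψ ⟨x, hx⟩ = 1)
    (θ : Gamma (M * p) →* Q)
    (hθ : ∀ (g x : SL(2, ℤ)) (hx : x ∈ Gamma (M * p)) (hgx : g * x * g⁻¹ ∈ Gamma (M * p)),
      θ ⟨g * x * g⁻¹, hgx⟩ = θ ⟨x, hx⟩) :
    ∀ (x : SL(2, ℤ)) (hx : x ∈ Gamma (M * p)), x ∈ Gamma M₀ → θ ⟨x, hx⟩ = 1 := by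
  classical
  haveI := Gamma_normal M
  haveI := Gamma_normal (M * p)
  haveI : NeZero (M * p) := ⟨Nat.mul_ne_zero (NeZero.ne M) hp.ne_zero⟩
  have hle : Gamma (M * p) ≤ Gamma M := Gamma_le_Gamma_of_dvd₅ (dvd_mul_right M p)
  set H : Subgroup (Gamma M) := (Gamma (M * p)).subgroupOf (Gamma M) with hH
  haveI : H.Normal := by rw [hH]; infer_instance
  haveI : H.FiniteIndex := by rw [hH]; infer_instance
  set ϕ : H →* Q := θ.comp (Subgroup.subgroupOfEquivOfLe hle).toMonoidHom with hϕ
  have hϕapply : ∀ (y : Gamma M) (hy : y ∈ H), ϕ ⟨y, hy⟩ = θ ⟨(y : SL(2, ℤ)), hy⟩ := fun y hy ↦ rfl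
  have hϕinv : ∀ (g h : Gamma M) (hh : h ∈ H) (hgh : g * h * g⁻¹ ∈ H),
      ϕ ⟨g * h * g⁻¹, hgh⟩ = ϕ ⟨h, hh⟩ := by
    intro g h hh hgh
    rw [hϕapply, hϕapply]
    exact hθ g h hh hgh
  set ψ : Gamma M →* Q := MonoidHom.transfer ϕ with hψ
  have hψN : ∀ (x : SL(2, ℤ)) (hx : x ∈ Gamma (M * p)),
      ψ ⟨x, hle hx⟩ = θ ⟨x, hx⟩ ^ H.index := by
    intro x hx
    have hxH : (⟨x, hle hx⟩ : Gamma M) ∈ H := Subgroup.mem_subgroupOf.mpr hx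
    rw [hψ, transfer_eq_pow_of_forall_conj ϕ hϕinv ⟨x, hle hx⟩ hxH, hϕapply]
  obtain ⟨n, hn⟩ := exists_index_subgroupOf_Gamma_mul_eq_pow hp hpM
  have hidx : H.index.Coprime e := by rw [← hH] at hn; rw [hn]; exact Nat.Coprime.pow_left n hcop.symm
  -- `ψ` is invariant
  have hψinv : ∀ (g x : SL(2, ℤ)) (hx : x ∈ Gamma M) (hgx : g * x * g⁻¹ ∈ Gamma M),
      ψ ⟨g * x * g⁻¹, hgx⟩ = ψ ⟨x, hx⟩ := by
    intro g x hx hgx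
    set σ : MulAut (Gamma M) := MulAut.conjNormal g with hσ
    have hσx : (⟨g * x * g⁻¹, hgx⟩ : Gamma M) = σ ⟨x, hx⟩ :=
      Subtype.ext (by rw [hσ, MulAut.conjNormal_apply])
    rw [hσx, ← mul_inv_eq_one]
    set y : Gamma M := ⟨x, hx⟩ with hy
    -- the defect has order dividing the index (a power of `p`) and dividing `e`
    refine eq_one_of_pow_eq_one_of_coprime hidx ?_ (hQ _)
    have hyH : y ^ H.index ∈ H := Subgroup.pow_index_mem H y
    have hyN : ((y ^ H.index : Gamma M) : SL(2, ℤ)) ∈ Gamma (M * p) := Subgroup.mem_subgroupOf.mp hyH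
    have hσyN : ((σ (y ^ H.index) : Gamma M) : SL(2, ℤ)) ∈ Gamma (M * p) := by
      rw [hσ, MulAut.conjNormal_apply]
      exact (Gamma_normal (M * p)).conj_mem _ hyN g
    rw [mul_pow, inv_pow, ← map_pow, ← map_pow, ← map_pow, mul_inv_eq_one]
    have h1 : ψ (σ (y ^ H.index)) = θ ⟨_, hσyN⟩ ^ H.index := by
      have := hψN _ hσyN
      rw [← this]
    have h2 : ψ (y ^ H.index) = θ ⟨_, hyN⟩ ^ H.index := by
      have := hψN _ hyN
      rw [← this]
    rw [h1, h2]
    congr 1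
    have h3 : ((σ (y ^ H.index) : Gamma M) : SL(2, ℤ)) =
        g * ((y ^ H.index : Gamma M) : SL(2, ℤ)) * g⁻¹ := by
      rw [hσ, MulAut.conjNormal_apply]
    calc θ ⟨_, hσyN⟩ = θ ⟨g * ((y ^ H.index : Gamma M) : SL(2, ℤ)) * g⁻¹, h3 ▸ hσyN⟩ :=
          congrArg θ (Subtype.ext h3)
      _ = θ ⟨_, hyN⟩ := hθ g _ hyN (h3 ▸ hσyN)
  -- conclusion
  intro x hx hx₀
  have h1 : θ ⟨x, hx⟩ ^ H.index = 1 := by rw [← hψN x hx]; exact hM ψ hψinv x (hle hx) hx₀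
  exact eq_one_of_pow_eq_one_of_coprime hidx h1 (hQ _)

end UnboundedDenominators

end Literature.NumberTheory.Automorphic
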